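import Literature.MathematicalPhysics.QuantumFieldTheory.Balaban1983to89.B8LeafSocketsB9
import Literature.MathematicalPhysics.QuantumFieldTheory.Balaban1983to89.B9SupplySockB9P3Zd

/-!
# `Balaban1983to89.B8LeafSocketsB9OfThm33` — [Balaban1985RegularSpaces] p. 86 «Theorem 3.3 of [4] implies the bounds (1.59)»: the N06
# supply (`B9SupplySockB9P3Zd.sockB9P3_allLevels_of_thm33`, seat `pub-ymgap-dag-n06-b`) UNPACKED INTO THE N05 KNIT'S b9 BINDER `SB9all`
# with the knit's constant windows (`2 ≤ 5dL·B₀`, `0 < B₀β`) — the junction J-N06→N05 certified by elaboration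

statement-level skeleton of published theorems with citation tags; proofs where landed; nothing here is a claim about the
Yang–Mills mass gap

PDF held: `paper:balaban1985-cmp99-regular-spaces-gauge-fixing` (journal page = PDF page + 74), p. 86 ((1.58)–(1.59)), p. 88 (Theorem 4,
`B₁′ = 5dLB₀`); [4] = [Balaban1985BackgroundPropagators] Thm 3.3 p. 399.

WHY THIS FILE (cell `pub-ymgap`, seat `pub-ymgap-dag-n05-a` g6, KNIT seat of DAG node N05 = [B8]; junction J-N06→N05 of dag-lead WORDS-94 /
REBALANCE №9; count-neutral).  The N05 knit `B8LeafKnitZd3B9All.b8LeafRS_zd3_univ_b9all` reads the in-edge b9 as ONE binder per member,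
`SB9all : ∀ m ≤ i.k, SockB9P3 L inp.B₀ B₀β cB9 β len i.η m i.Ω i.Λs i.Λb`, under Theorem 4's window `2 ≤ 5dL·inp.B₀` and `0 < B₀β`; the N06
supplier proves from [4] THEOREM 3.3 AS A SENTENCE (`B9.Thm33Printed`, any B9 frame with a member map) plus the displayed operator binders
of [4] Sect. A the ∃-package `∃ B₀ B₀β cP, 0 < B₀ ∧ 0 ≤ B₀β ∧ 0 < cP ∧ ∀ i m, m ≤ i.k → SockB9P3 …`.  This file composes the two BY NAME
through the monotonicity glue `B8LeafSocketsB9.sockB9P3_allLevels_unpack`: the package with the knit's windows.  The closer then fixes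
`inp.B₀ := B₀` FIRST and asks the Proposition-5 providers at that `inp` (their sockets are not monotone in `B₀`).

WHAT IS PROVED (kernel, 0 sorry, theorems only): **`sB9all_of_thm33`** — `B9.Thm33Printed c35 geo bg Gp GA` + n06-b's binders (`DictGlob`,
`Prop6Feed`, `InvOnSupp`, `CurvSmall`, `LandauKills`, `AvgBound`, `HolderGlob`, signs) ⇒ `∃ B₀ B₀β cP, 0 < B₀ ∧ 2 ≤ 5dL·B₀ ∧ 0 < B₀β ∧
0 < cP ∧ ∀ i : ZdIdx d L, ∀ m ≤ i.k, SockB9P3 L B₀ B₀β cP β len i.η m i.Ω i.Λs i.Λb` (`d ≥ 2`, `L ≥ 1`).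

HONEST SCOPE.  Composition by name; [4] Thm 3.3 and the letters `G(U₀), Δ′(U₀), R(U₀), Q*` are NOT constructed (object-bound, n06-b's
declared scope); count-neutral; N05/N06 NOT discharged; nothing continuum / ℝ⁴ / OS / mass-gap / Clay.  Unit `pub-ymgap-dag-n05-a` (g6),
2026-08-26.
-/

noncomputable section

namespace Literature.MathematicalPhysics.QuantumFieldTheory.Balaban1983to89.B8LeafSocketsB9OfThm33

open B7Prop1Explicit B7Prop2Explicit
open B8LeafModelZd (ZdIdx)
open B8LeafModelZd3 (SockB9P3)
open B8LeafSocketsB9 (sockB9P3_allLevels_unpack)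
open B9SupplySockB9P3ZdLetters (OpsZd DictGlob Prop6Feed InvOnSupp CurvSmall LandauKills AvgBound HolderGlob)
open B9SupplySockB9P3Zd (sockB9P3_allLevels_of_thm33)

-- `Site` alone could resolve to the torus sites of `Setup.lean`; re-export the `ℤ^d` sites of `B7Prop1Explicit`.
export B7Prop1Explicit (Site)

variable {d : ℕ} {𝔸 : Type*} [CStarAlgebra 𝔸] [Nontrivial 𝔸]

section Junction

variable {I : Type} (geo : I → B9.Geometry) (bg : I → B9.Backgrounds) (GA : ∀ i, B9.KernelFamily (geo i) (bg i))
variable (L : ℕ) (mem : ℝ → ZdIdx d L → ℕ → I)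
variable (ιCfg : ∀ (M : ℝ) (i : ZdIdx d L) (m : ℕ) (U₀ : Site d → Fin d → 𝔸ˣ),
  (∀ x κ, U₀ x κ ∈ unitaryUnits 𝔸) → (bg (mem M i m)).Cfg)
variable (ιLoc : ∀ (M : ℝ) (i : ZdIdx d L) (m : ℕ), (Site d → Fin d → 𝔸) → (geo (mem M i m)).Loc)
variable (ops : ℝ → ZdIdx d L → ℕ → OpsZd d 𝔸)

/-- **J-N06→N05 BY NAME: [4] THEOREM 3.3 (as the sentence `B9.Thm33Printed`) + the displayed [4] Sect. A binders ⇒ the N05 knit's b9 binder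
`SB9all` at EVERY member of `ZdIdx d L`, with Theorem 4's window `2 ≤ 5dL·B₀` and `0 < B₀β`** — n06-b's `sockB9P3_allLevels_of_thm33`
composed with `sockB9P3_allLevels_unpack` (socket monotone in `B₀`, `B₀β`).  Feed the result to `B8LeafKnitZd3B9All.b8LeafRS_zd3_univ_b9all`
with `inp := ⟨B₀, B₀′, _, _⟩`. [cite: Balaban1985RegularSpaces, (1.58)–(1.59) p.86, Thm 4 p.88; Balaban1985BackgroundPropagators, Thm 3.3 p.399] -/
theorem sB9all_of_thm33 (hd2 : 2 ≤ d) (hL : 1 ≤ L) {c35 c₆ K₆ M₃ a₃ c69 q CH β : ℝ} {len : Site d → ℝ}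
    {Gp : ∀ i, B9.KernelFamily (geo i) (bg i)} (h33 : B9.Thm33Printed c35 geo bg Gp GA)
    (hdict : DictGlob geo bg GA L mem ιCfg ιLoc ops) (hP6 : Prop6Feed bg L mem ιCfg c35 M₃ c₆ K₆)
    (hinv : InvOnSupp bg L mem ιCfg ops c35 M₃ a₃) (hcurv : CurvSmall bg L mem ιCfg ops c35 M₃ a₃ c69)
    (hlan : LandauKills bg L mem ιCfg ops c35 M₃ a₃) (havg : AvgBound L ops q)
    (hhol : HolderGlob geo bg GA L mem ιCfg ops β len CH)
    (hc₆ : 0 < c₆) (hK₆ : 0 < K₆) (ha₃ : 0 < a₃) (hc69 : 0 ≤ c69) (hq : 0 ≤ q) :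
    ∃ B₀ B₀β cP : ℝ, 0 < B₀ ∧ 2 ≤ 5 * (d : ℝ) * L * B₀ ∧ 0 < B₀β ∧ 0 < cP ∧
      ∀ (i : ZdIdx d L) (m : ℕ), m ≤ i.k → SockB9P3 (𝔸 := 𝔸) L B₀ B₀β cP β len i.η m i.Ω i.Λs i.Λb :=
  sockB9P3_allLevels_unpack (le_trans (by norm_num) hd2) hL (fun i : ZdIdx d L => i.η) (fun i => i.hη) (fun i => i.k) (fun i => i.Ω)
    (fun i => i.Λs) (fun i => i.Λb)
    (sockB9P3_allLevels_of_thm33 geo bg GA L mem ιCfg ιLoc ops hd2 hL h33 hdict hP6 hinv hcurv hlan havg hhol hc₆ hK₆ ha₃ hc69 hq)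

end Junction

#print axioms sB9all_of_thm33

end Literature.MathematicalPhysics.QuantumFieldTheory.Balaban1983to89.B8LeafSocketsB9OfThm33

end
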